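import Summits.HodgeConjecture.HodgeConjecture.Theorems.Ring2HabitatWeilDiscriminantEuler
import Mathlib.NumberTheory.Cyclotomic.PrimitiveRoots
import HarnessLib

/-!
# Weil-type family coverage — the TWISTED TRACE GRAM DETERMINANT `det (Tr(α ωᵢ ωⱼ)) = N(α)·disc(ω)` and
# EULER'S EVALUATION `Tr(ζ^j/Φₙ′(ζ)) = δ_{j, φ(n)−1}` (the two generic identities behind the census's
# component rule)

research route conditional on HC_CM; not a corollary; Q11.4-sentence-2 already refuted in dim ≥ 3.

Ring 2, WEIL-TYPE FAMILY-COVERAGE CENSUS (`HOME/WEIL-FAMILY-COVERAGE.md` `## b01`, blocks b01.41 (C) «COMPONENTS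
(S-pencil, exact)» and b01.46 (E) «NOT CLAIMED: the component classes in the kernel», owner ring2-b01), part 81 of
the `Ring2WeilCoverage*` series.  Van Geemen's discriminant class `det H ∈ ℚˣ/Nm(Kˣ)` of a polarised abelian
variety of Weil type [vG94 Lemma 5.2 (3)] is, for the census's CM points `(ℂ^Φ/Φ(𝔪), E_ζ′)` read in a REAL frame,
the determinant of a rational matrix `(Tr_{K⁺/ℚ}(γ ωᵢ ωⱼ))ᵢⱼ` (part 82).  This file proves the two pieces of
pure algebra that evaluate such determinants:

* §1 (any commutative `K`-algebra `L` with a finite basis `b`, any `α ∈ L`):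
  **`of_trace_mul_mul_eq`: `(Tr_{L/K}(α·bᵢbⱼ))ᵢⱼ = traceMatrix(b) · leftMulMatrix_b(α)`**, hence
  **`det_of_trace_mul_mul`: `det (Tr_{L/K}(α·bᵢbⱼ)) = N_{L/K}(α) · disc_{L/K}(b)`** and the COMPONENT RULE at
  matrix level **`det_of_trace_mul_mul_mul`: `det (Tr(βα·bᵢbⱼ)) = N(β) · det (Tr(α·bᵢbⱼ))`**.
* §2 (a finite separable field extension `L/K` with a power basis `pb`, `f = minpoly`): EULER'S LEMMA
  `trace_gen_pow_div_aeval_derivative`: `Tr_{L/K}(x^j/f′(x)) = [j = dim − 1]` for `j < dim` — this is habitat1's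
  LEMMA E (a) `Ring2.Habitat.trace_pow_mul_inv_derivAtGen` (`Ring2HabitatWeilDiscriminantEuler`, gen 22; count once
  theirs), re-indexed by a natural number — and its polynomial form **`trace_aeval_div_aeval_derivative`:
  `Tr(P(x)/f′(x)) = coeff_{dim−1}(P)` for `deg P < dim`** (the evaluation engine of parts 83+).  Habitat1's file
  also has the power-basis case of §1 (`det_traceGram`) and the Euler normalisation `det (Tr(βθ^{i+j}/f′(θ))) =
  (−1)^{m(m−1)/2} N(β)`; §1 here is the arbitrary-basis form needed for the maximal real subfield `K⁺ ⊂ K` of part 82,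
  which comes with no power basis in the tree.
* §3 the cyclotomic case `K = ℚ(ζₙ)` (`f = Φₙ`, `dim = φ(n)`): `trace_zeta_pow_div`, `trace_aeval_zeta_div`,
  `trace_aeval_zeta_mul_inv` — the census's `ξ_k = ζ^k·Φₙ′(ζ)⁻¹` (part 6′) has `Tr(ξ_k) = [k = φ(n) − 1]`, and
  every `Tr_{ℚ(ζₙ)/ℚ}(P(ζ)·Φₙ′(ζ)⁻¹)` is ONE coefficient of `P mod Φₙ` (the evaluation engine of parts 83+).

HONEST FRAMING: linear algebra and field theory only (Mathlib's `Algebra.trace`, `Algebra.norm`, `Algebra.discr`,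
`PowerBasis`, `minpolyDiv`); nothing here mentions Hodge classes, polarisations, `W_K` or HC; `HC_CM` is used
nowhere.  No `def`, no named fact, no `sorry`.

References: [cite: vanGeemen1994HodgeAV, Lemma 5.2 (2)–(3)] (where these determinants are used); Euler's lemma
`Tr(x^j/f′(x)) = δ` [cite: NeukirchANT1999, Ch. III (2.4) Proposition] (proof via the dual basis; Mathlib
`traceDual_powerBasis_eq`); census b01.41 (C), b01.46 (E) (seat-derived).
-/

noncomputable section

open Polynomial Module

namespace Summit.HodgeConjecture.Ring2WeilCoverage.TraceGramDeterminant

open Summit.HodgeConjecture.HodgeConjecture.Ring2.Habitat (trace_pow_mul_inv_derivAtGen)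

/-! ### §1 The twisted trace Gram matrix -/

section Generic

variable {K L : Type*} [CommRing K] [CommRing L] [Algebra K L] {ι : Type*} [Fintype ι] [DecidableEq ι]

/-- **`(Tr_{L/K}(α·bᵢbⱼ))ᵢⱼ = traceMatrix(b) · leftMulMatrix_b(α)`**: expanding `α·bⱼ = Σ_k (leftMulMatrix α)_{kj} b_k`
in the basis `b`.
research route conditional on HC_CM; not a corollary; Q11.4-sentence-2 already refuted in dim ≥ 3. [folklore] -/
theorem of_trace_mul_mul_eq (b : Basis ι K L) (α : L) :
    (Matrix.of fun i j => Algebra.trace K L (α * (b i * b j))) =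
      Algebra.traceMatrix K b * Algebra.leftMulMatrix b α := by
  ext i j
  rw [Matrix.mul_apply, Matrix.of_apply]
  have h : α * b j = ∑ k, (Algebra.leftMulMatrix b α k j) • b k := by
    conv_lhs => rw [← b.sum_repr (α * b j)]
    simp_rw [Algebra.leftMulMatrix_eq_repr_mul]
  calc Algebra.trace K L (α * (b i * b j)) = Algebra.trace K L (b i * (α * b j)) := by ring_nf
    _ = Algebra.trace K L (b i * ∑ k, (Algebra.leftMulMatrix b α k j) • b k) := by rw [h]
    _ = ∑ k, Algebra.leftMulMatrix b α k j * Algebra.trace K L (b i * b k) := by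
        rw [Finset.mul_sum, map_sum]
        refine Finset.sum_congr rfl fun k _ => ?_
        rw [mul_smul_comm, map_smul, smul_eq_mul]
    _ = ∑ k, Algebra.traceMatrix K b i k * Algebra.leftMulMatrix b α k j := by
        refine Finset.sum_congr rfl fun k _ => ?_
        rw [Algebra.traceMatrix_apply, Algebra.traceForm_apply, mul_comm]

/-- **THE TWISTED TRACE GRAM DETERMINANT: `det (Tr_{L/K}(α·bᵢbⱼ))ᵢⱼ = N_{L/K}(α) · disc_{L/K}(b)`** for a basis
`b` of the `K`-algebra `L` and any `α ∈ L`.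
research route conditional on HC_CM; not a corollary; Q11.4-sentence-2 already refuted in dim ≥ 3. [folklore] -/
theorem det_of_trace_mul_mul (b : Basis ι K L) (α : L) :
    (Matrix.of fun i j => Algebra.trace K L (α * (b i * b j))).det = Algebra.norm K α * Algebra.discr K b := by
  rw [of_trace_mul_mul_eq, Matrix.det_mul, Algebra.discr_def, Algebra.norm_eq_matrix_det b, mul_comm]

/-- **THE COMPONENT RULE (matrix level): `det (Tr(β·α·bᵢbⱼ)) = N_{L/K}(β) · det (Tr(α·bᵢbⱼ))`** — twisting the
parameter `α` by `β` multiplies the Gram determinant by the norm of `β`.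
research route conditional on HC_CM; not a corollary; Q11.4-sentence-2 already refuted in dim ≥ 3. [folklore] -/
theorem det_of_trace_mul_mul_mul (b : Basis ι K L) (α β : L) :
    (Matrix.of fun i j => Algebra.trace K L (β * α * (b i * b j))).det =
      Algebra.norm K β * (Matrix.of fun i j => Algebra.trace K L (α * (b i * b j))).det := by
  rw [det_of_trace_mul_mul, det_of_trace_mul_mul, map_mul, mul_assoc]

/-- At `α = 1` the twisted Gram determinant is the discriminant.
research route conditional on HC_CM; not a corollary; Q11.4-sentence-2 already refuted in dim ≥ 3. [folklore] -/
theorem det_of_trace_mul (b : Basis ι K L) :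
    (Matrix.of fun i j => Algebra.trace K L (b i * b j)).det = Algebra.discr K b := by
  have h := det_of_trace_mul_mul b 1
  simp only [one_mul, map_one] at h
  exact h

end Generic

/-! ### §2 Euler's lemma `Tr(x^j/f′(x)) = δ_{j, dim−1}` -/

section Euler

variable {K L : Type*} [Field K] [Field L] [Algebra K L] [FiniteDimensional K L] [Algebra.IsSeparable K L]

/-- **EULER'S LEMMA: `Tr_{L/K}(x^j / f′(x)) = 1` if `j = dim − 1` and `= 0` if `j < dim − 1`** (`x` the generator of
a power basis, `f` its minimal polynomial) — habitat1's `trace_pow_mul_inv_derivAtGen` (LEMMA E (a)) with a natural-number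
exponent.
research route conditional on HC_CM; not a corollary; Q11.4-sentence-2 already refuted in dim ≥ 3. [cite: NeukirchANT1999, Ch. III (2.4) Proposition] -/
theorem trace_gen_pow_div_aeval_derivative (pb : PowerBasis K L) {j : ℕ} (hj : j < pb.dim) :
    Algebra.trace K L (pb.gen ^ j / aeval pb.gen (derivative (minpoly K pb.gen))) =
      if j + 1 = pb.dim then 1 else 0 := by
  rw [div_eq_mul_inv]
  exact trace_pow_mul_inv_derivAtGen pb ⟨j, hj⟩

/-- **EULER'S LEMMA, polynomial form: `Tr_{L/K}(P(x)/f′(x)) = coeff_{dim−1}(P)` for every `P ∈ K[X]` with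
`deg P < dim`.**
research route conditional on HC_CM; not a corollary; Q11.4-sentence-2 already refuted in dim ≥ 3. [cite: NeukirchANT1999, Ch. III (2.4) Proposition] -/
theorem trace_aeval_div_aeval_derivative (pb : PowerBasis K L) (P : K[X]) (hP : P.natDegree < pb.dim) :
    Algebra.trace K L (aeval pb.gen P / aeval pb.gen (derivative (minpoly K pb.gen))) = P.coeff (pb.dim - 1) := by
  have hdim : 0 < pb.dim := pb.dim_pos
  rw [aeval_eq_sum_range' hP, Finset.sum_div, map_sum]
  have hterm : ∀ k ∈ Finset.range pb.dim,
      Algebra.trace K L (P.coeff k • pb.gen ^ k / aeval pb.gen (derivative (minpoly K pb.gen))) =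
        if k = pb.dim - 1 then P.coeff k else 0 := by
    intro k hk
    rw [Finset.mem_range] at hk
    rw [smul_div_assoc, map_smul, trace_gen_pow_div_aeval_derivative pb hk, smul_eq_mul, mul_ite, mul_one,
      mul_zero]
    by_cases h1 : k + 1 = pb.dim
    · rw [if_pos h1, if_pos (by omega)]
    · rw [if_neg h1, if_neg (by omega)]
  rw [Finset.sum_congr rfl hterm, Finset.sum_ite_eq' (Finset.range pb.dim) (pb.dim - 1) (fun k => P.coeff k),
    if_pos (Finset.mem_range.mpr (by omega))]

end Euler

/-! ### §3 The cyclotomic case: `Tr_{ℚ(ζₙ)/ℚ}(ζ^j/Φₙ′(ζ)) = δ_{j, φ(n)−1}` -/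

section Cyclotomic

variable {K : Type*} [Field K] [NumberField K] {n : ℕ} [NeZero n] {ζ : K}

/-- The power basis of `ζ` over `ℚ` has minimal polynomial `Φₙ` and dimension `φ(n)`.
research route conditional on HC_CM; not a corollary; Q11.4-sentence-2 already refuted in dim ≥ 3. [folklore] -/
theorem minpoly_powerBasis_gen_eq [IsCyclotomicExtension {n} ℚ K] (hζ : IsPrimitiveRoot ζ n) :
    minpoly ℚ (hζ.powerBasis ℚ).gen = cyclotomic n ℚ ∧ (hζ.powerBasis ℚ).dim = Nat.totient n := by
  have hmin : minpoly ℚ ζ = cyclotomic n ℚ := (cyclotomic_eq_minpoly_rat hζ (NeZero.pos n)).symm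
  refine ⟨by rw [IsPrimitiveRoot.powerBasis_gen]; exact hmin, ?_⟩
  rw [IsPrimitiveRoot.powerBasis_dim, hmin, natDegree_cyclotomic]

/-- **`Tr_{ℚ(ζₙ)/ℚ}(ζ^j / Φₙ′(ζ)) = 1` if `j = φ(n) − 1`, `= 0` if `j < φ(n) − 1`** (Euler at `f = Φₙ`).
research route conditional on HC_CM; not a corollary; Q11.4-sentence-2 already refuted in dim ≥ 3. [cite: NeukirchANT1999, Ch. III (2.4) Proposition] -/
theorem trace_zeta_pow_div [IsCyclotomicExtension {n} ℚ K] (hζ : IsPrimitiveRoot ζ n) {j : ℕ}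
    (hj : j < Nat.totient n) :
    Algebra.trace ℚ K (ζ ^ j / aeval ζ (derivative (cyclotomic n ℚ))) =
      if j + 1 = Nat.totient n then 1 else 0 := by
  obtain ⟨hmin, hdim⟩ := minpoly_powerBasis_gen_eq hζ
  have h := trace_gen_pow_div_aeval_derivative (hζ.powerBasis ℚ) (j := j) (by rw [hdim]; exact hj)
  rw [hmin, hdim, IsPrimitiveRoot.powerBasis_gen] at h
  exact h

/-- **`Tr_{ℚ(ζₙ)/ℚ}(P(ζ)/Φₙ′(ζ)) = coeff_{φ(n)−1}(P)`** for `deg P < φ(n)`: every trace of the census is ONE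
coefficient of a reduced polynomial.
research route conditional on HC_CM; not a corollary; Q11.4-sentence-2 already refuted in dim ≥ 3. [cite: NeukirchANT1999, Ch. III (2.4) Proposition] -/
theorem trace_aeval_zeta_div [IsCyclotomicExtension {n} ℚ K] (hζ : IsPrimitiveRoot ζ n) (P : ℚ[X])
    (hP : P.natDegree < Nat.totient n) :
    Algebra.trace ℚ K (aeval ζ P / aeval ζ (derivative (cyclotomic n ℚ))) = P.coeff (Nat.totient n - 1) := by
  obtain ⟨hmin, hdim⟩ := minpoly_powerBasis_gen_eq hζ
  have h := trace_aeval_div_aeval_derivative (hζ.powerBasis ℚ) P (by rw [hdim]; exact hP)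
  rw [hmin, hdim, IsPrimitiveRoot.powerBasis_gen] at h
  exact h

/-- The same with the census's spelling `P(ζ)·Φₙ′(ζ)⁻¹` (part 6′ writes `ξ_k = ζ^k·Φₙ′(ζ)⁻¹`).
research route conditional on HC_CM; not a corollary; Q11.4-sentence-2 already refuted in dim ≥ 3. [cite: NeukirchANT1999, Ch. III (2.4) Proposition] -/
theorem trace_aeval_zeta_mul_inv [IsCyclotomicExtension {n} ℚ K] (hζ : IsPrimitiveRoot ζ n) (P : ℚ[X])
    (hP : P.natDegree < Nat.totient n) :
    Algebra.trace ℚ K (aeval ζ P * (aeval ζ (derivative (cyclotomic n ℚ)))⁻¹) = P.coeff (Nat.totient n - 1) := by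
  rw [← div_eq_mul_inv]
  exact trace_aeval_zeta_div hζ P hP

/-- **`Tr(ξ_k) = [k = φ(n) − 1]`** for the census generator `ξ_k = ζ^k·Φₙ′(ζ)⁻¹` of `𝔡⁻¹`, `k < φ(n)`.
research route conditional on HC_CM; not a corollary; Q11.4-sentence-2 already refuted in dim ≥ 3. [cite: NeukirchANT1999, Ch. III (2.4) Proposition] -/
theorem trace_xi [IsCyclotomicExtension {n} ℚ K] (hζ : IsPrimitiveRoot ζ n) {k : ℕ} (hk : k < Nat.totient n) :
    Algebra.trace ℚ K (ζ ^ k * (aeval ζ (derivative (cyclotomic n ℚ)))⁻¹) =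
      if k + 1 = Nat.totient n then 1 else 0 := by
  rw [← div_eq_mul_inv]
  exact trace_zeta_pow_div hζ hk

end Cyclotomic

end Summit.HodgeConjecture.Ring2WeilCoverage.TraceGramDeterminant

end
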